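import Mathlib
import Summits.KontsevichZagierPeriods.KontsevichZagierPeriods.Theorems.SoloInformedDiscCancellation
import HarnessLib
import HarnessLib.Audit

/-!
# SoloInformed — the volume ladder splits rung by rung: `Rung = LocRung ∧ DiscCanc`

`Theorems/SoloInformedVolumeLadder.lean`: `KZP ⟺ ∀ d, Rung_d` (volume rung `d`: equal `d`-volumes of
compact `ℚ`-semialgebraic sets ⇒ connected by the four moves).  `Theorems/SoloInformedLocSplit.lean`:
`KZP ⟺ KZLocAt ⟦[π]⟧ ∧ KZ.PiCancellation`.  `Theorems/SoloInformedDiscCancellation.lean`: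
`KZ.PiCancellation ⟺ ∀ d, DiscCanc_d`.  This file puts the FIRST conjunct on the same ladder:

* `SoloInformedLocVolumeRung d` — *localised volume rung `d`*: two volume representations of
  dimension `d` with the same volume have the same class in `P` after multiplication by a power of
  `⟦[π]⟧` (`⟦[π]⟧ⁿ·⟦[K]⟧ = ⟦[π]⟧ⁿ·⟦[K']⟧`, i.e. the cylinders `D̄ⁿ × K`, `D̄ⁿ × K'` are connected by the
  moves);
* `soloInformed_kzLocPi_iff_forall_locVolumeRung` — **`KZLocAt ⟦[π]⟧ ⟺ ∀ d, LocRung_d`** (volume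
  normal form of formal combinations, `soloInformed_exists_volumeRep_sub`);
* `soloInformed_locVolumeRung_of_volumeRung` (`n = 0`), `soloInformed_locVolumeRung_mono` (nested),
  hence `LocRung_d` for `d ≤ 1` unconditionally and for `d ≤ 2` granted Huber–Wüstholz;
* `soloInformed_volumeRung_of_locVolumeRung_of_piCancellation` — **rung by rung,
  `LocRung_d ∧ KZ.PiCancellation ⇒ Rung_d`** (cancel the power of `⟦[π]⟧`), and conversely
  `Rung_d ⇒ LocRung_d`, `Rung_d ⇒ DiscCanc_d`;
* `soloInformed_kzp_iff_forall_locVolumeRung_and_discCancellation` — with no hypotheses,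
  `KZP ⟺ (∀ d ≥ 3, LocRung_d) ∧ (∀ d ≥ 3, DiscCanc_d)`.

Reading.  On one ladder the conjecture separates into a transcendence half (`LocRung_d`: "equal
volume ⇒ equal up to a disc factor"; rung `3` already gives `π² ∉ ℚ·log 2·log 3` — an open case of the
weak four-exponentials conjecture — by the same torus/box instance as for `Rung_3`, since `⟦[π]⟧`
becomes invertible in the Nori period algebra) and a
combinatorial half (`DiscCanc_d`: "a disc factor cancels"), both theorems for `d ≤ 2` and both open
from `d = 3` on.

References: M. Kontsevich, D. Zagier, *Periods* (2001), §1.2, §4.1; J. Ayoub, EMS Newsl. 91 (2014),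
Conj. 7; A. Huber, G. Wüstholz, *Transcendence and linear relations of 1-periods* (CUP 2022),
Thm. 13.3, App. A.3; J. Cresson, J. Viu-Sos, JTNB 34 (2022), §1.
-/

noncomputable section

open Set MeasureTheory

open Literature.NumberTheory.Transcendental KZ

namespace Summit.KontsevichZagierPeriods.KontsevichZagierPeriods.Theorems

/-- **Localised volume rung `d`.** Two volume representations of dimension `d` with equal volume have
equal classes in the formal period ring after multiplication by some power of `⟦[π]⟧`. -/
def SoloInformedLocVolumeRung (d : ℕ) : Prop :=
  ∀ K K' : IntegralRep d, SoloInformedIsVolumeRep K → SoloInformedIsVolumeRep K' →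
    K.value = K'.value →
      ∃ n : ℕ, toFormalPeriod (of piRep) ^ n * toFormalPeriod (of K) =
        toFormalPeriod (of piRep) ^ n * toFormalPeriod (of K')

/-! ### Down from the volume rung, and nesting -/

/-- Volume rung `d` ⇒ localised volume rung `d` (take `n = 0`). -/
theorem soloInformed_locVolumeRung_of_volumeRung {d : ℕ} (h : SoloInformedVolumeRung d) :
    SoloInformedLocVolumeRung d := fun K K' hK hK' hv =>
  ⟨0, by simpa using Equivalent.toFormalPeriod_eq (h K K' hK.1 hK.2.1 hK'.1 hK'.2.1 hK.2.2 hK'.2.2 hv)⟩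

/-- Localised volume rung holds unconditionally for `d ≤ 1`. -/
theorem soloInformed_locVolumeRung_le_one {d : ℕ} (hd : d ≤ 1) : SoloInformedLocVolumeRung d :=
  soloInformed_locVolumeRung_of_volumeRung (soloInformed_volumeRung_le_one hd)

/-- Localised volume rung holds for `d ≤ 2`, granted the Huber–Wüstholz theorem on curve periods. -/
theorem soloInformed_locVolumeRung_le_two (hHW : HuberWustholzCurvePeriods) {d : ℕ} (hd : d ≤ 2) :
    SoloInformedLocVolumeRung d :=
  soloInformed_locVolumeRung_of_volumeRung (soloInformed_volumeRung_le_two hHW hd)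

/-- The value of the unit slab over a volume representation is its value. -/
theorem soloInformed_value_slab {d : ℕ} (K : IntegralRep d) : (K.slab 0).value = K.value :=
  (Equivalent.value_eq_holds (K.equivalent_slab 0)).symm

/-- **Monotonicity**: localised volume rung `d + 1` implies rung `d` (unit slabs). -/
theorem soloInformed_locVolumeRung_mono {d : ℕ} (h : SoloInformedLocVolumeRung (d + 1)) :
    SoloInformedLocVolumeRung d := by
  intro K K' hK hK' hv
  obtain ⟨n, hn⟩ := h _ _ (soloInformed_isVolumeRep_slab hK) (soloInformed_isVolumeRep_slab hK')
    (by rw [soloInformed_value_slab, soloInformed_value_slab, hv])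
  refine ⟨n, ?_⟩
  rw [Equivalent.toFormalPeriod_eq (K.equivalent_slab 0),
    Equivalent.toFormalPeriod_eq (K'.equivalent_slab 0)]
  exact hn

/-- Localised volume rung `d'` implies every rung `d ≤ d'`. -/
theorem soloInformed_locVolumeRung_of_le {d d' : ℕ} (hle : d ≤ d')
    (h : SoloInformedLocVolumeRung d') : SoloInformedLocVolumeRung d := by
  induction hle with
  | refl => exact h
  | step _ ih => exact ih (soloInformed_locVolumeRung_mono h)

/-! ### `KZLocAt ⟦[π]⟧` is the conjunction of the localised volume rungs -/

/-- **THEOREM: `KZLocAt ⟦[π]⟧ ⟺ ∀ d, LocRung_d`.** (`⇐`: for `x, y ∈ P` with equal values write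
`x − y = ⟦[M]⟧ − ⟦[M']⟧` in volume normal form; equal values give `vol M = vol M'`, the localised
rung a power `n` with `⟦π⟧ⁿ⟦M⟧ = ⟦π⟧ⁿ⟦M'⟧`, i.e. `⟦π⟧ⁿ x = ⟦π⟧ⁿ y`.) -/
theorem soloInformed_kzLocPi_iff_forall_locVolumeRung :
    SoloInformedKZLocAt (toFormalPeriod (of piRep)) soloInformed_evalP_piRep_ne_zero ↔
      ∀ d, SoloInformedLocVolumeRung d := by
  rw [soloInformed_kzLocAt_iff]
  constructor
  · intro h d K K' _ _ hv
    exact h _ _ (by rw [evalP_toFormalPeriod_of, evalP_toFormalPeriod_of, hv])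
  · intro h x y hxy
    obtain ⟨cx, rfl⟩ := toFormalPeriod_surjective x
    obtain ⟨cy, rfl⟩ := toFormalPeriod_surjective y
    obtain ⟨N, M, M', hM, hM', e⟩ := soloInformed_exists_volumeRep_sub (cx - cy)
    have hdiff : toFormalPeriod cx - toFormalPeriod cy = toFormalPeriod (of M) - toFormalPeriod (of M') := by
      have := toFormalPeriod_eq_zero_iff.2 e
      rw [map_sub, map_sub, map_sub, sub_eq_zero] at this
      exact this
    have hv : M.value = M'.value := by
      have h0 := congrArg evalP hdiff
      rw [map_sub, map_sub, hxy, sub_self, evalP_toFormalPeriod_of, evalP_toFormalPeriod_of] at h0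
      linarith
    obtain ⟨n, hn⟩ := h N M M' hM hM' hv
    refine ⟨n, ?_⟩
    rw [← sub_eq_zero, ← mul_sub, hdiff, mul_sub, sub_eq_zero]
    exact hn

/-- KZP ⇒ every localised volume rung. -/
theorem soloInformed_locVolumeRung_of_kzp (h : KontsevichZagierPeriods) (d : ℕ) :
    SoloInformedLocVolumeRung d :=
  soloInformed_kzLocPi_iff_forall_locVolumeRung.1 (soloInformed_kzLocAt_of_kzp h _ _) d

/-! ### Rung by rung: `Rung_d ⟸ LocRung_d ∧ PiCancellation` -/

/-- **Rung by rung**: the localised volume rung `d` together with `KZ.PiCancellation` gives the volume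
rung `d` (cancel the power of `⟦[π]⟧`, `soloInformed_pow_cancel`). -/
theorem soloInformed_volumeRung_of_locVolumeRung_of_piCancellation {d : ℕ}
    (hL : SoloInformedLocVolumeRung d) (hC : PiCancellation) : SoloInformedVolumeRung d := by
  intro K K' hKc hKi hK'c hK'i hK1 hK'1 hv
  obtain ⟨n, hn⟩ := hL K K' ⟨hKc, hKi, hK1⟩ ⟨hK'c, hK'i, hK'1⟩ hv
  have hcancel := soloInformed_piCancellation_iff_cancel.1 hC
  have h0 : toFormalPeriod (of K) - toFormalPeriod (of K') = 0 :=
    soloInformed_pow_cancel hcancel n _ (by rw [mul_sub, sub_eq_zero]; exact hn)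
  rw [← map_sub, toFormalPeriod_eq_zero_iff] at h0
  exact h0

/-- Conversely the volume rung `d` gives both halves at rung `d`. -/
theorem soloInformed_locVolumeRung_and_discCancellationRung_of_volumeRung {d : ℕ}
    (h : SoloInformedVolumeRung d) :
    SoloInformedLocVolumeRung d ∧ SoloInformedDiscCancellationRung d :=
  ⟨soloInformed_locVolumeRung_of_volumeRung h, soloInformed_discCancellationRung_of_volumeRung h⟩

/-! ### The summit on one ladder, split into its two halves -/

/-- **THEOREM (no hypotheses): `KZP ⟺ (∀ d, LocRung_d) ∧ (∀ d, DiscCanc_d)`.** -/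
theorem soloInformed_kzp_iff_forall_locVolumeRung_and_forall_discCancellationRung :
    KontsevichZagierPeriods ↔
      (∀ d, SoloInformedLocVolumeRung d) ∧ ∀ d, SoloInformedDiscCancellationRung d := by
  rw [← soloInformed_kzLocPi_iff_forall_locVolumeRung,
    ← soloInformed_piCancellation_iff_forall_discCancellationRung]
  exact soloInformed_kzp_iff_locPi_and_piCancellation

/-- `∀ d, LocRung_d` iff `∀ d ≥ d₀, LocRung_d` (monotonicity). -/
theorem soloInformed_forall_locVolumeRung_iff_ge (d₀ : ℕ) :
    (∀ d, SoloInformedLocVolumeRung d) ↔ ∀ d, d₀ ≤ d → SoloInformedLocVolumeRung d :=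
  ⟨fun h d _ => h d, fun h d =>
    soloInformed_locVolumeRung_of_le (Nat.le_max_right d₀ d) (h _ (Nat.le_max_left d₀ d))⟩

/-- **THEOREM (no hypotheses): the summit is the two open ladders from rung `3` on** —
`KZP ⟺ (∀ d ≥ 3, LocRung_d) ∧ (∀ d ≥ 3, DiscCanc_d)`; rungs `≤ 2` of both ladders are theorems
(granted Huber–Wüstholz for rung `2`). -/
theorem soloInformed_kzp_iff_forall_locVolumeRung_and_discCancellation :
    KontsevichZagierPeriods ↔
      (∀ d, 3 ≤ d → SoloInformedLocVolumeRung d) ∧ ∀ d, 3 ≤ d → SoloInformedDiscCancellationRung d := by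
  rw [← soloInformed_forall_locVolumeRung_iff_ge, ← soloInformed_piCancellation_iff_discCancellation_ge,
    ← soloInformed_kzLocPi_iff_forall_locVolumeRung]
  exact soloInformed_kzp_iff_locPi_and_piCancellation

end Summit.KontsevichZagierPeriods.KontsevichZagierPeriods.Theorems
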